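import Summits.HubbardSuperconductivity.HubbardSuperconductivity.Theorems.AnisotropyChordTransferCompressibilityResponse
import Summits.HubbardSuperconductivity.HubbardSuperconductivity.Theorems.AnisotropyChordTransferSectorZeroGround

/-!
# Route `AnisotropyChord` / H0 rotor rung, route (1): COMPRESSIBILITY + f-SUM + `k = 0` FEYNMAN SATURATION ⇒ BEC (END-TO-END), and `⟨a, c a⟩ = 0`
# (delta of the theory seat's `PartH.lean` v5, sha16 0ac8b9eae0592ec2, over the tree ports `…TransferCompressibility` (p667525) and
# `…TransferCompressibilityResponse`; theory seat `hubbard-h0-rotor-theory-1` g12, memo ROTOR-THEORY-12 §184(i),(k); critic-4 g9 verdict cell INBOX l.475: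
# CORRECT / REPRODUCED / levers KNOWN-IN-PRINT (Pitaevskii–Stringari 1991 = Stringari 1995 eqs. (10)–(11); Feynman 1954 / Wagner 1966 = eqs. (15)–(16);
# Griffin 1993 (9.32)–(9.33)) / problem-relative grade VARIANT; R₀ OPEN; VERBATIM port of the theory seat's `PartHDelta.lean`
# sha16 bdb920ce20c574fd by prover seat `hubbard-h0-rotor-p1` g15 — port only)

* `condensate_of_compressibility_saturation` — for `0 ≤ Δ < 1`: anchor `HalfFillingAnchor Δ c₀` + (K ∧ F ∧ R₀ with `0 < κ, 0 < f₀, 0 < c_s` on the sectors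
  `|j| ≤ k + 1`, eventually in `L`) ⇒ `CondensateOnFirstSectors Δ k` (the tree's conditional THEOREM T `condensateOnFirstSectors_of_symmetricGap` composed with
  `symmetricSectorGap_of_compressibility_saturation`; positivity of `c₁ = c_s √(f₀/κ)` per critic g9 P4);
* `condensate_xy_of_compressibility_saturation` — the XY point, anchor = the tree's KLS `halfFillingAnchor_xy`;
* `strucMean_eq_zero_of_perron` — `⟨a, c a⟩ = Σ_σ a(σ)·(c a)(σ) = 0` for every Perron sector amplitude (`L ≥ 2`): translation invariance
  (`perronTranslationInvariant_holds`) + `Σ_{x ∈ ℤ/L} cos(2πx/L) = 0` (roots of unity) — so the Legendre supremum in HYPOTHESIS K `DensityResponseBound` is finite for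
  the objects it is applied to (critic g9 P2).
-/

set_option linter.dupNamespace false
set_option autoImplicit false

noncomputable section

open Finset Filter Topology
open Literature.MathematicalPhysics.QuantumLattice Literature.Probability.LatticeModels
open Summit.HubbardSuperconductivity.HubbardSuperconductivity.Theorems.AnisotropyChord.InsertionEntropy
open Summit.HubbardSuperconductivity.HubbardSuperconductivity.Theorems.AnisotropyChord.Tower

namespace Summit.HubbardSuperconductivity.HubbardSuperconductivity.Theorems.AnisotropyChord.Transfer

variable {L : ℕ} [NeZero L]

/-! ## End-to-end: compressibility + f-sum + `k = 0` Feynman saturation ⇒ BEC -/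

/-- **COROLLARY (END-TO-END TO BEC, `0 ≤ Δ < 1`):** KLS-type anchor + compressibility K + f-sum F + `k = 0` Feynman saturation R₀, with constants
`0 < κ, 0 < f₀, 0 < c_s` uniform on the sectors `|j| ≤ k + 1`, eventually in `L` ⇒ `CondensateOnFirstSectors Δ k` (tree THEOREM T, p663036).
[conjecture: theory seat hubbard-h0-rotor-theory-1, cycle 12 — PROVED here from the tree's conditional T; positivity per critic g9 P4] -/
theorem condensate_of_compressibility_saturation {Δ κ f₀ cs c₀ : ℝ} {k : ℕ} (hΔ0 : 0 ≤ Δ) (hΔ1 : Δ < 1)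
    (hκ : 0 < κ) (hf₀ : 0 < f₀) (hcs : 0 < cs) (hc₀ : 0 < c₀) (hA : HalfFillingAnchor Δ c₀)
    (h : ∀ᶠ L : ℕ in atTop, ∀ [NeZero L], ∀ j : ℤ, |j| ≤ ((k + 1 : ℕ) : ℤ) →
      DensityResponseBound L Δ (j : ℝ) κ ∧ FsumLower L Δ (j : ℝ) f₀ ∧ PhononSaturationBelowSym (L := L) Δ (j : ℝ) cs) :
    CondensateOnFirstSectors Δ k := by
  have hc₁ : 0 < cs * Real.sqrt (f₀ / κ) := mul_pos hcs (Real.sqrt_pos.2 (div_pos hf₀ hκ))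
  exact condensateOnFirstSectors_of_symmetricGap hΔ0 hΔ1 hc₀ hc₁ hA
    (symmetricSectorGap_of_compressibility_saturation hκ hcs.le h)

/-- **COROLLARY (XY point, hard-core bosons on `(ℤ/L)²`, anchor = KLS 1988 in the tree):** compressibility + f-sum + `k = 0` Feynman saturation on the
sectors `|j| ≤ k + 1` ⇒ BEC in every sector `N = L²/2 + j`, `j ≤ k`, eventually in `L`.
[conjecture: theory seat hubbard-h0-rotor-theory-1, cycle 12 — PROVED here from the tree's conditional T] -/
theorem condensate_xy_of_compressibility_saturation {κ f₀ cs : ℝ} {k : ℕ}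
    (hκ : 0 < κ) (hf₀ : 0 < f₀) (hcs : 0 < cs)
    (h : ∀ᶠ L : ℕ in atTop, ∀ [NeZero L], ∀ j : ℤ, |j| ≤ ((k + 1 : ℕ) : ℤ) →
      DensityResponseBound L 0 (j : ℝ) κ ∧ FsumLower L 0 (j : ℝ) f₀ ∧ PhononSaturationBelowSym (L := L) 0 (j : ℝ) cs) :
    CondensateOnFirstSectors 0 k := by
  have hc₁ : 0 < cs * Real.sqrt (f₀ / κ) := mul_pos hcs (Real.sqrt_pos.2 (div_pos hf₀ hκ))
  exact condensateOnFirstSectors_xy_of_symmetricGap hc₁ (symmetricSectorGap_of_compressibility_saturation hκ hcs.le h)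

/-! ## Hygiene for K (critic g9 P2): `⟨a, c a⟩ = 0` for translation-invariant `a`, `L ≥ 2`

So the Legendre supremum in `DensityResponseBound` is finite for the true Perron amplitude (`perronTranslationInvariant_holds`). -/

/-- the occupation moment `Σ_σ a(σ)² n_s(σ)` is translation invariant when `a` is. [folklore] -/
theorem occMoment_shift {a : TensorIndex (TorusSite 2 L) 2 → ℝ} (hinv : ∀ v σ, a (shiftCfg L v σ) = a σ)
    (s v : TorusSite 2 L) :
    ∑ σ, a σ ^ 2 * occNum L σ (s + v) = ∑ σ, a σ ^ 2 * occNum L σ s := by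
  have hbij : Function.Bijective (shiftCfg L v) := by
    refine ⟨fun σ τ h => ?_, fun τ => ⟨shiftCfg L (-v) τ, ?_⟩⟩
    · funext t
      have := congrFun h (t - v)
      simpa [shiftCfg, sub_add_cancel] using this
    · funext t; simp [shiftCfg]
  calc ∑ σ, a σ ^ 2 * occNum L σ (s + v)
      = ∑ σ, (fun τ => a τ ^ 2 * occNum L τ s) (shiftCfg L v σ) := by
        refine Finset.sum_congr rfl fun σ _ => ?_
        simp only [hinv v σ, occNum, shiftCfg]
    _ = ∑ σ, a σ ^ 2 * occNum L σ s := hbij.sum_comp (fun τ => a τ ^ 2 * occNum L τ s)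

/-- `Σ_{x ∈ ℤ/L} cos(2πx/L) = 0` for `L ≥ 2` (real part of the vanishing sum of the `L`-th roots of unity). [folklore] -/
theorem sum_cos_zmod_eq_zero (hL : 2 ≤ L) :
    ∑ x : ZMod L, Real.cos (2 * Real.pi * (x.val : ℝ) / (L : ℝ)) = 0 := by
  obtain ⟨n, hn⟩ : ∃ n, L = n + 1 := ⟨L - 1, by omega⟩
  subst hn
  have key : ∑ i ∈ Finset.range (n + 1), Complex.exp (2 * Real.pi * Complex.I / ((n + 1 : ℕ) : ℂ)) ^ i = 0 :=
    (Complex.isPrimitiveRoot_exp (n + 1) (by omega)).geom_sum_eq_zero (by omega)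
  rw [← Fin.sum_univ_eq_sum_range] at key
  have hre := congrArg Complex.re key
  rw [Complex.re_sum, Complex.zero_re] at hre
  have hterm : ∀ i : Fin (n + 1),
      (Complex.exp (2 * Real.pi * Complex.I / ((n + 1 : ℕ) : ℂ)) ^ (i : ℕ)).re
        = Real.cos (2 * Real.pi * ((i : ℕ) : ℝ) / ((n + 1 : ℕ) : ℝ)) := by
    intro i
    rw [← Complex.exp_nat_mul, ← Complex.exp_ofReal_mul_I_re]
    congr 1
    push_cast
    ring
  simp only [hterm] at hre
  exact hre

/-- `Σ_{s ∈ (ℤ/L)²} cos(2π s₀/L) = 0` for `L ≥ 2`. [folklore] -/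
theorem sum_cosSite_eq_zero (hL : 2 ≤ L) :
    ∑ s : TorusSite 2 L, Real.cos (2 * Real.pi * ((s 0).val : ℝ) / (L : ℝ)) = 0 := by
  rw [Fintype.sum_equiv (piFinTwoEquiv fun _ => ZMod L)
      (fun s : TorusSite 2 L => Real.cos (2 * Real.pi * ((s 0).val : ℝ) / (L : ℝ)))
      (fun p => Real.cos (2 * Real.pi * (p.1.val : ℝ) / (L : ℝ))) (fun s => rfl)]
  rw [Fintype.sum_prod_type]
  simp only [Finset.sum_const, Finset.card_univ, nsmul_eq_mul]
  rw [← Finset.mul_sum, sum_cos_zmod_eq_zero hL, mul_zero]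

/-- **`⟨a, c a⟩ = 0`:** the Feynman vector is orthogonal to a translation-invariant `a` (`L ≥ 2`), so K's Legendre supremum is finite
for the Perron amplitude. [folklore] -/
theorem strucMean_eq_zero {a : TensorIndex (TorusSite 2 L) 2 → ℝ} (hinv : ∀ v σ, a (shiftCfg L v σ) = a σ) (hL : 2 ≤ L) :
    ∑ σ, a σ * feynmanVec L a σ = 0 := by
  have D : ∀ s, ∑ σ, a σ ^ 2 * occNum L σ s = ∑ σ, a σ ^ 2 * occNum L σ 0 := fun s => by
    simpa using occMoment_shift hinv 0 s
  calc ∑ σ, a σ * feynmanVec L a σ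
      = ∑ σ, ∑ s : TorusSite 2 L, Real.cos (2 * Real.pi * ((s 0).val : ℝ) / (L : ℝ)) * (a σ ^ 2 * occNum L σ s) := by
        refine Finset.sum_congr rfl fun σ _ => ?_
        simp only [feynmanVec, cosWave, Finset.mul_sum, Finset.sum_mul]
        refine Finset.sum_congr rfl fun s _ => by ring
    _ = ∑ s : TorusSite 2 L, Real.cos (2 * Real.pi * ((s 0).val : ℝ) / (L : ℝ)) * ∑ σ, a σ ^ 2 * occNum L σ s := by
        rw [Finset.sum_comm]
        refine Finset.sum_congr rfl fun s _ => by rw [Finset.mul_sum]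
    _ = (∑ s : TorusSite 2 L, Real.cos (2 * Real.pi * ((s 0).val : ℝ) / (L : ℝ))) * ∑ σ, a σ ^ 2 * occNum L σ 0 := by
        rw [Finset.sum_mul]
        refine Finset.sum_congr rfl fun s _ => by rw [D s]
    _ = 0 := by rw [sum_cosSite_eq_zero hL, zero_mul]

/-- hence, for the Perron amplitude of any sector (tree: `perronTranslationInvariant_holds`), `⟨a, c a⟩ = 0`. [folklore] -/
theorem strucMean_eq_zero_of_perron {Δ M : ℝ} {a : TensorIndex (TorusSite 2 L) 2 → ℝ}
    (ha : IsPerronSectorGroundAmplitude L Δ M a) (hL : 2 ≤ L) :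
    ∑ σ, a σ * feynmanVec L a σ = 0 :=
  strucMean_eq_zero (perronTranslationInvariant_holds Δ L M a ha) hL

end Summit.HubbardSuperconductivity.HubbardSuperconductivity.Theorems.AnisotropyChord.Transfer
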